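import Literature.Computability.Complexity.CliqueTestGraphs
import Literature.Computability.Complexity.CliqueCounting
import Mathlib

/-!
# The vertex-core dichotomy for families of short edge sets (`shortMaxterms_core`)
(crux `ConvexRankGates.CliqueExtLowerBound`, stmt-PneNP-10682; line `width-threshold-certificate-sparsity`,
registered sub-goal `shortMaxterms_core` of the skeleton, lead c12)

Pure finite combinatorics, no asymptotics, no gates. For a family `𝓛` of nonempty edge sets of `K_m`,
each with `≤ w` edges, and a budget `q`: EITHER there is a vertex set `W` with `#W ≤ 4 w² q` such that
every member of `𝓛` has an edge with both endpoints in `W`, OR at most `(2w)^q · C(m-q, k-q)` of the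
clique vectors of the `k`-subsets of `Fin m` (`posGraphs m k`) meet every member of `𝓛`.

Proof. `2w` rounds. In a round with current core `W`, look at the members with no edge inside `W`;
their vertex sets outside `W` ("outside parts", `≤ 2w` vertices each) are nonempty. Take a subfamily
with pairwise-disjoint outside parts of maximum cardinality. If it has `≥ q` members, a clique meeting
every member contains a vertex of each of `q` pairwise-disjoint outside parts, so the accepted `k`-sets
are covered by the `≤ (2w)^q` events "`S ⊇ range t`", `t` a choice function, each of size
`≤ C(m-q, k-q)` (`card_filter_supset_powersetCard_le`): second alternative (`card_filter_le_of_parts`).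
Otherwise add the `< q` outside parts to `W` (`≤ 2wq` new vertices); by maximality every member with
no edge inside the old core gains a vertex in the new one (`round_step`). After `t` rounds a member
with no edge inside the core has `≥ t` vertices in it (`rounds`); vertex sets have `≤ 2w` vertices,
so after `2w` rounds every member has an edge inside the core, whose size is `≤ 2w · 2wq = 4w²q`.

The vertex-set map is kept abstract in the helper statements (`vx` with its two properties: it
contains the endpoints of the member's edges, and has `≤ 2w` vertices); the main theorem instantiates
it with the union of the endpoint sets. No definitions are introduced.
-/

set_option linter.dupNamespace false

open Literature.Computability.Complexity Finset

namespace Summit.PneNP.PneNP.Theorems.CliqueExtLowerBound.WidthThreshold.ShortMaxtermsCore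

variable {m : ℕ}

/-- An edge of `K_m` (an unordered pair of vertices) has at most two endpoints. [folklore] -/
theorem card_filter_mem_edge_le_two (e : Sym2 (Fin m)) :
    #((univ : Finset (Fin m)).filter fun v => v ∈ e) ≤ 2 := by
  induction e using Sym2.ind with
  | _ a b =>
    have h : ((univ : Finset (Fin m)).filter fun v => v ∈ s(a, b)) = {a, b} := by
      ext v
      simp
    rw [h]
    exact Finset.card_le_two

/-- The vertex set of an edge set `L` (the union of the endpoint sets of its edges) has at most
`2 · #L` vertices. [folklore] -/
theorem card_vertexSet_le (L : Finset ((⊤ : SimpleGraph (Fin m)).edgeSet)) :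
    #(L.biUnion fun e => (univ : Finset (Fin m)).filter fun v => v ∈ (e : Sym2 (Fin m))) ≤ 2 * #L :=
  calc _ ≤ ∑ e ∈ L, #((univ : Finset (Fin m)).filter fun v => v ∈ (e : Sym2 (Fin m))) :=
        card_biUnion_le
    _ ≤ ∑ _e ∈ L, 2 := sum_le_sum fun e _ => card_filter_mem_edge_le_two _
    _ = 2 * #L := by rw [sum_const, smul_eq_mul, mul_comm]

/-- **Counting step.** If `q` members `𝓕` of the family have pairwise-disjoint "parts" `O L` of
`≤ 2w` vertices each, and every `k`-set whose clique vector meets every member of `𝓛` contains a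
vertex of each of these parts, then at most `(2w)^q · C(m-q, k-q)` clique vectors meet every member
of `𝓛`: the accepted `k`-sets are covered by the events "`S ⊇ range t`" over the
`∏ #(O L) ≤ (2w)^q` choice functions `t ∈ 𝓕.pi O`, and each range is a `q`-set (the parts are
disjoint) contained in `≤ C(m-q, k-q)` of the `k`-sets (`card_filter_supset_powersetCard_le`;
none if `q > k`). [folklore] -/
theorem card_filter_le_of_parts (k w q : ℕ)
    (𝓛 𝓕 : Finset (Finset ((⊤ : SimpleGraph (Fin m)).edgeSet)))
    (O : Finset ((⊤ : SimpleGraph (Fin m)).edgeSet) → Finset (Fin m))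
    (hcard : #𝓕 = q) (hO : ∀ L ∈ 𝓕, #(O L) ≤ 2 * w)
    (hdisj : (𝓕 : Set (Finset ((⊤ : SimpleGraph (Fin m)).edgeSet))).PairwiseDisjoint O)
    (hhit : ∀ S : Finset (Fin m), (∀ L ∈ 𝓛, ∃ e ∈ L, cliqueVec S e = true) →
      ∀ L ∈ 𝓕, ∃ v ∈ O L, v ∈ S) :
    #((posGraphs m k).filter fun x => ∀ L ∈ 𝓛, ∃ e ∈ L, x e = true) ≤
      (2 * w) ^ q * (m - q).choose (k - q) := by
  classical
  -- every choice function `t ∈ 𝓕.pi O` has a range of exactly `q` vertices, contained in few `k`-sets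
  have hT : ∀ t ∈ 𝓕.pi O,
      #((powersetCard k (univ : Finset (Fin m))).filter fun S =>
        (𝓕.attach.image fun L => t L.1 L.2) ⊆ S) ≤ (m - q).choose (k - q) := by
    intro t ht
    rw [Finset.mem_pi] at ht
    set T : Finset (Fin m) := 𝓕.attach.image fun L => t L.1 L.2 with hTdef
    have hTq : #T = q := by
      rw [hTdef, card_image_of_injOn, card_attach, hcard]
      rintro ⟨L₁, hL₁⟩ - ⟨L₂, hL₂⟩ - h
      have h' : t L₁ hL₁ = t L₂ hL₂ := h
      by_contra hne
      have hd : Disjoint (O L₁) (O L₂) := hdisj hL₁ hL₂ fun h'' => hne (Subtype.ext h'')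
      have hv₂ : t L₁ hL₁ ∈ O L₂ := h' ▸ ht L₂ hL₂
      exact disjoint_left.1 hd (ht L₁ hL₁) hv₂
    by_cases hqk : q ≤ k
    · calc _ ≤ (#(univ : Finset (Fin m)) - #T).choose (k - #T) :=
            card_filter_supset_powersetCard_le univ T (by rw [hTq]; exact hqk)
        _ = (m - q).choose (k - q) := by rw [card_univ, Fintype.card_fin, hTq]
    · rw [filter_false_of_mem, card_empty]
      · exact Nat.zero_le _
      · intro S hS hTS
        have h := card_le_card hTS
        rw [hTq, (mem_powersetCard.1 hS).2] at h
        exact hqk h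
  -- reduce from clique vectors to `k`-sets and cover these by the choice functions
  unfold posGraphs
  rw [filter_image]
  refine card_image_le.trans ?_
  calc _ ≤ #((𝓕.pi O).biUnion fun t => (powersetCard k (univ : Finset (Fin m))).filter fun S =>
          (𝓕.attach.image fun L => t L.1 L.2) ⊆ S) := by
        refine card_le_card fun S hS => ?_
        simp only [mem_filter] at hS
        obtain ⟨hSk, hSP⟩ := hS
        have hch := hhit S hSP
        choose t ht using hch
        rw [mem_biUnion]
        refine ⟨fun L hL => t L hL, Finset.mem_pi.2 fun L hL => (ht L hL).1, ?_⟩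
        rw [mem_filter]
        refine ⟨hSk, fun v hv => ?_⟩
        rw [mem_image] at hv
        obtain ⟨⟨L, hL⟩, -, rfl⟩ := hv
        exact (ht L hL).2
    _ ≤ ∑ t ∈ 𝓕.pi O, #((powersetCard k (univ : Finset (Fin m))).filter fun S =>
          (𝓕.attach.image fun L => t L.1 L.2) ⊆ S) := card_biUnion_le
    _ ≤ ∑ _t ∈ 𝓕.pi O, (m - q).choose (k - q) := sum_le_sum hT
    _ = (∏ L ∈ 𝓕, #(O L)) * (m - q).choose (k - q) := by rw [sum_const, smul_eq_mul, card_pi]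
    _ ≤ (2 * w) ^ q * (m - q).choose (k - q) := by
        refine Nat.mul_le_mul_right _ ?_
        rw [← hcard]
        exact prod_le_pow_card _ _ _ hO

/-- **One round.** Given the current core `W` and an abstract vertex-set map `vx` (containing the
endpoints of each member's edges, `≤ 2w` vertices), either the second alternative of the dichotomy
already holds, or `W` extends by `≤ 2wq` vertices to a core `W'` containing, OUTSIDE `W`, a vertex
of every member of `𝓛` that has no edge inside `W`. Proof: take a maximum-cardinality subfamily of
the members with no edge inside `W` whose outside parts `vx L \ W` are pairwise disjoint
(`Finset.exists_max_image`); if it has `≥ q` members apply `card_filter_le_of_parts` (an edge of a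
clique that is not inside `W` has an endpoint in the outside part), else add its `< q` outside parts
to `W` and use maximality. [folklore] -/
theorem round_step (k w q : ℕ) (𝓛 : Finset (Finset ((⊤ : SimpleGraph (Fin m)).edgeSet)))
    (vx : Finset ((⊤ : SimpleGraph (Fin m)).edgeSet) → Finset (Fin m))
    (h𝓛 : ∀ L ∈ 𝓛, L.Nonempty ∧ #L ≤ w)
    (hvx1 : ∀ L ∈ 𝓛, ∀ e ∈ L, ∀ v ∈ (e : Sym2 (Fin m)), v ∈ vx L)
    (hvx2 : ∀ L ∈ 𝓛, #(vx L) ≤ 2 * w) (W : Finset (Fin m)) :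
    #((posGraphs m k).filter fun x => ∀ L ∈ 𝓛, ∃ e ∈ L, x e = true) ≤
        (2 * w) ^ q * (m - q).choose (k - q) ∨
      ∃ W' : Finset (Fin m), W ⊆ W' ∧ #W' ≤ #W + 2 * w * q ∧
        ∀ L ∈ 𝓛, (¬ ∃ e ∈ L, ∀ v ∈ (e : Sym2 (Fin m)), v ∈ W) →
          ∃ v ∈ vx L, v ∈ W' ∧ v ∉ W := by
  classical
  -- the members with no edge inside `W`
  obtain ⟨𝓛W, h𝓛W⟩ : ∃ 𝓛W : Finset (Finset ((⊤ : SimpleGraph (Fin m)).edgeSet)),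
      ∀ L, L ∈ 𝓛W ↔ L ∈ 𝓛 ∧ ¬ ∃ e ∈ L, ∀ v ∈ (e : Sym2 (Fin m)), v ∈ W :=
    ⟨𝓛.filter fun L : Finset ((⊤ : SimpleGraph (Fin m)).edgeSet) =>
      ¬ ∃ e ∈ L, ∀ v ∈ (e : Sym2 (Fin m)), v ∈ W, fun L => mem_filter⟩
  -- the subfamilies of `𝓛W` with pairwise-disjoint outside parts `vx L \ W`; one of maximum size
  obtain ⟨P, hP⟩ : ∃ P : Finset (Finset (Finset ((⊤ : SimpleGraph (Fin m)).edgeSet))),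
      ∀ 𝓕, 𝓕 ∈ P ↔ 𝓕 ⊆ 𝓛W ∧
        (𝓕 : Set (Finset ((⊤ : SimpleGraph (Fin m)).edgeSet))).PairwiseDisjoint fun L => vx L \ W :=
    ⟨𝓛W.powerset.filter fun 𝓕 : Finset (Finset ((⊤ : SimpleGraph (Fin m)).edgeSet)) =>
      (𝓕 : Set (Finset ((⊤ : SimpleGraph (Fin m)).edgeSet))).PairwiseDisjoint fun L => vx L \ W,
      fun 𝓕 => by rw [mem_filter, mem_powerset]⟩
  obtain ⟨𝓕, h𝓕P, h𝓕max⟩ :=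
    exists_max_image P Finset.card ⟨∅, (hP ∅).2 ⟨empty_subset _, by simp⟩⟩
  obtain ⟨h𝓕sub, h𝓕disj⟩ := (hP 𝓕).1 h𝓕P
  -- an edge of a member with no edge inside `W` has an endpoint in the outside part
  have hout : ∀ L ∈ 𝓛, ∀ e ∈ L, (¬ ∃ e ∈ L, ∀ v ∈ (e : Sym2 (Fin m)), v ∈ W) →
      ∃ v ∈ (e : Sym2 (Fin m)), v ∈ vx L \ W := by
    intro L hL e he hnot
    by_contra hno
    push Not at hno
    exact hnot ⟨e, he, fun v hv => Classical.byContradiction fun hvW =>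
      hno v hv (mem_sdiff.2 ⟨hvx1 L hL e he v hv, hvW⟩)⟩
  by_cases hq : q ≤ #𝓕
  · -- `≥ q` pairwise-disjoint outside parts: the second alternative
    left
    obtain ⟨𝓕', h𝓕'sub, h𝓕'card⟩ := exists_subset_card_eq hq
    have h𝓕'𝓛 : ∀ L ∈ 𝓕', L ∈ 𝓛 ∧ ¬ ∃ e ∈ L, ∀ v ∈ (e : Sym2 (Fin m)), v ∈ W := fun L hL =>
      (h𝓛W L).1 (h𝓕sub (h𝓕'sub hL))
    refine card_filter_le_of_parts k w q 𝓛 𝓕' (fun L => vx L \ W) h𝓕'card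
      (fun L hL => (card_le_card sdiff_subset).trans (hvx2 L (h𝓕'𝓛 L hL).1))
      (h𝓕disj.subset (coe_subset.2 h𝓕'sub)) fun S hS L hL => ?_
    obtain ⟨e, he, hSe⟩ := hS L (h𝓕'𝓛 L hL).1
    have hSe' : ∀ v ∈ (e : Sym2 (Fin m)), v ∈ S := by simpa [cliqueVec] using hSe
    obtain ⟨v, hv, hvO⟩ := hout L (h𝓕'𝓛 L hL).1 e he (h𝓕'𝓛 L hL).2
    exact ⟨v, hvO, hSe' v hv⟩
  · -- `< q` parts: absorb them into the core
    right
    push Not at hq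
    refine ⟨W ∪ 𝓕.biUnion fun L => vx L \ W, subset_union_left, ?_, fun L hL hnot => ?_⟩
    · have h1 : #(𝓕.biUnion fun L => vx L \ W) ≤ #𝓕 * (2 * w) :=
        card_biUnion_le_card_mul _ _ _ fun L hL =>
          (card_le_card sdiff_subset).trans (hvx2 L ((h𝓛W L).1 (h𝓕sub hL)).1)
      have h2 : #𝓕 * (2 * w) ≤ 2 * w * q := by
        rw [mul_comm (2 * w) q]
        exact Nat.mul_le_mul_right _ hq.le
      calc #(W ∪ 𝓕.biUnion fun L => vx L \ W) ≤ #W + #(𝓕.biUnion fun L => vx L \ W) :=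
            card_union_le _ _
        _ ≤ #W + #𝓕 * (2 * w) := Nat.add_le_add_left h1 _
        _ ≤ #W + 2 * w * q := Nat.add_le_add_left h2 _
    · have hL𝓛W : L ∈ 𝓛W := (h𝓛W L).2 ⟨hL, hnot⟩
      by_cases hLF : L ∈ 𝓕
      · -- a member of the subfamily: its (nonempty) outside part went into the core
        obtain ⟨e, he⟩ := (h𝓛 L hL).1
        obtain ⟨v, -, hv⟩ := hout L hL e he hnot
        exact ⟨v, (mem_sdiff.1 hv).1, mem_union_right _ (mem_biUnion.2 ⟨L, hLF, hv⟩),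
          (mem_sdiff.1 hv).2⟩
      · -- otherwise, by maximality, its outside part meets an absorbed outside part
        by_contra hno
        push Not at hno
        have hins : insert L 𝓕 ∈ P := by
          refine (hP _).2 ⟨insert_subset hL𝓛W h𝓕sub, ?_⟩
          rw [coe_insert]
          refine h𝓕disj.insert fun L' hL' _ => ?_
          show Disjoint (vx L \ W) (vx L' \ W)
          rw [Finset.disjoint_left]
          intro v hvL hvL'
          exact (mem_sdiff.1 hvL).2
            (hno v (mem_sdiff.1 hvL).1 (mem_union_right _ (mem_biUnion.2 ⟨L', hL', hvL'⟩)))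
        have hle := h𝓕max _ hins
        rw [card_insert_of_notMem hLF] at hle
        omega

/-- **Iteration.** Unless the second alternative holds, after `t` rounds there is a core of
`≤ 2wq · t` vertices containing `≥ t` vertices of the vertex set of every member that still has no
edge inside it (induction on `t` with `round_step`: the new core contains the old one and a new vertex
of every such member). [folklore] -/
theorem rounds (k w q : ℕ) (𝓛 : Finset (Finset ((⊤ : SimpleGraph (Fin m)).edgeSet)))
    (vx : Finset ((⊤ : SimpleGraph (Fin m)).edgeSet) → Finset (Fin m))
    (h𝓛 : ∀ L ∈ 𝓛, L.Nonempty ∧ #L ≤ w)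
    (hvx1 : ∀ L ∈ 𝓛, ∀ e ∈ L, ∀ v ∈ (e : Sym2 (Fin m)), v ∈ vx L)
    (hvx2 : ∀ L ∈ 𝓛, #(vx L) ≤ 2 * w)
    (hne : ¬ #((posGraphs m k).filter fun x => ∀ L ∈ 𝓛, ∃ e ∈ L, x e = true) ≤
        (2 * w) ^ q * (m - q).choose (k - q)) (t : ℕ) :
    ∃ W : Finset (Fin m), #W ≤ 2 * w * q * t ∧
      ∀ L ∈ 𝓛, (¬ ∃ e ∈ L, ∀ v ∈ (e : Sym2 (Fin m)), v ∈ W) → t ≤ #(vx L ∩ W) := by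
  induction t with
  | zero => exact ⟨∅, by simp, fun L _ _ => Nat.zero_le _⟩
  | succ t ih =>
    obtain ⟨W, hWcard, hWinv⟩ := ih
    rcases round_step k w q 𝓛 vx h𝓛 hvx1 hvx2 W with h | ⟨W', hWW', hW'card, hW'⟩
    · exact absurd h hne
    refine ⟨W', ?_, fun L hL hnot => ?_⟩
    · calc #W' ≤ #W + 2 * w * q := hW'card
        _ ≤ 2 * w * q * t + 2 * w * q := Nat.add_le_add_right hWcard _
        _ = 2 * w * q * (t + 1) := by ring
    · have hnotW : ¬ ∃ e ∈ L, ∀ v ∈ (e : Sym2 (Fin m)), v ∈ W := fun ⟨e, he, heW⟩ =>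
        hnot ⟨e, he, fun v hv => hWW' (heW v hv)⟩
      obtain ⟨v, hvL, hvW', hvW⟩ := hW' L hL hnotW
      have hsub : insert v (vx L ∩ W) ⊆ vx L ∩ W' :=
        insert_subset (mem_inter.2 ⟨hvL, hvW'⟩) (inter_subset_inter_left hWW')
      have h1 := card_le_card hsub
      rw [card_insert_of_notMem fun h => hvW (mem_inter.1 h).2] at h1
      exact (Nat.succ_le_succ (hWinv L hL hnotW)).trans h1

/-- **The vertex-core dichotomy** (REGISTERED sub-goal `shortMaxterms_core` of the line
`width-threshold-certificate-sparsity`, crux stmt-PneNP-10682). For a family `𝓛` of nonempty edge sets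
of `K_m` each with `≤ w` edges and a budget `q`: EITHER there is a vertex set `W` of size `≤ 4 w² q`
such that every member of `𝓛` has an edge INSIDE `W`, OR at most `(2w)^q · C(m-q, k-q)` of the clique
vectors of the `k`-subsets of `Fin m` meet every member of `𝓛`. Proof: `rounds` with `t = 2w` and the
vertex-set map "union of the endpoint sets" (`card_vertexSet_le`): a member with no edge inside the
final core would have `≥ 2w ≥ #(vertex set)` of its vertices in the core, hence all of them, hence an
edge inside the core after all. [folklore] -/
theorem shortMaxterms_core : ∀ (m k w q : ℕ) (𝓛 : Finset (Finset ((⊤ : SimpleGraph (Fin m)).edgeSet))),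
    (∀ L ∈ 𝓛, L.Nonempty ∧ #L ≤ w) →
    (∃ W : Finset (Fin m), #W ≤ 4 * w ^ 2 * q ∧
        ∀ L ∈ 𝓛, ∃ e ∈ L, ∀ v ∈ (e : Sym2 (Fin m)), v ∈ W) ∨
    #((posGraphs m k).filter fun x => ∀ L ∈ 𝓛, ∃ e ∈ L, x e = true) ≤ (2 * w) ^ q * (m - q).choose (k - q) := by
  intro m k w q 𝓛 h𝓛
  by_cases hle : #((posGraphs m k).filter fun x => ∀ L ∈ 𝓛, ∃ e ∈ L, x e = true) ≤
      (2 * w) ^ q * (m - q).choose (k - q)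
  · exact Or.inr hle
  left
  have hvx1 : ∀ L ∈ 𝓛, ∀ e ∈ L, ∀ v ∈ (e : Sym2 (Fin m)),
      v ∈ L.biUnion fun e => (univ : Finset (Fin m)).filter fun v => v ∈ (e : Sym2 (Fin m)) :=
    fun L _ e he v hv => mem_biUnion.2 ⟨e, he, mem_filter.2 ⟨mem_univ _, hv⟩⟩
  have hvx2 : ∀ L ∈ 𝓛,
      #(L.biUnion fun e => (univ : Finset (Fin m)).filter fun v => v ∈ (e : Sym2 (Fin m))) ≤ 2 * w :=
    fun L hL => (card_vertexSet_le L).trans (Nat.mul_le_mul_left 2 (h𝓛 L hL).2)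
  obtain ⟨W, hWcard, hWinv⟩ := rounds k w q 𝓛 _ h𝓛 hvx1 hvx2 hle (2 * w)
  refine ⟨W, ?_, fun L hL => ?_⟩
  · calc #W ≤ 2 * w * q * (2 * w) := hWcard
      _ = 4 * w ^ 2 * q := by ring
  · by_contra hnot
    have hsub := inter_eq_left.1
      (eq_of_subset_of_card_le inter_subset_left ((hvx2 L hL).trans (hWinv L hL hnot)))
    obtain ⟨e, he⟩ := (h𝓛 L hL).1
    exact hnot ⟨e, he, fun v hv => hsub (hvx1 L hL e he v hv)⟩

end Summit.PneNP.PneNP.Theorems.CliqueExtLowerBound.WidthThreshold.ShortMaxtermsCore
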